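import Summits.HodgeConjecture.HodgeConjecture.Theorems.PeriodDeficiencyQbarGenericIsHodgeGenericTensorComparisonTransport
import Literature.AlgebraicGeometry.Motives.HodgeTensorHomProofs
import HarnessLib

/-!
# Route PeriodDeficiency — `QbarGenericIsHodgeGeneric` (stmt-HodgeConjecture-11595), line `registered`: stub `stub_mtRank_eq_of_tensorComparison` (S2 of reshape r6)

The registered stub `stub_mtRank_eq_of_tensorComparison` (S2 of reshape r6) of the line skeleton
`Cruxes/QbarGenericIsHodgeGeneric/Lines/birth.lean`, proved UNCONDITIONALLY.

**Statement.** Let `H`, `H'` be pure `ℚ`-Hodge structures of the same weight `n` on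
finite-dimensional `ℚ`-vector spaces `V`, `V'`, and let `ψ : ℂ ⊗ V ≃ ℂ ⊗ V'` be a `ℂ`-LINEAR
isomorphism of the complexifications such that for every `(a, b)` with `(a - b) n = 0` the tensor
functoriality `T ψ = ψ^{⊗a} ⊗ ((ψ⁻¹)ᵀ)^{⊗b}` carries the `ℂ`-span `S_H(a,b)` of the comparison
images `𝒞(1 ⊗ t)` of the weight-`0` Hodge tensors `t ∈ T^{a,b} V` of type `(0,0)` onto
`S_{H'}(a,b)` (here `𝒞 : ℂ ⊗ T^{a,b} V → (ℂ ⊗ V)^{⊗a} ⊗ ((ℂ ⊗ V)^∨)^{⊗b}` is the composite of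
the tree's comparison maps `tensorBaseChange`, `piTensorBaseChange`, `dualBaseChange`). Then
`dim MT(H) = dim MT(H')` (`HodgeStructure.mtRank`, the `ℚ`-dimension of the Mumford–Tate Lie
algebra `𝔪𝔱(H) ⊆ End V`, the annihilator of the weight-`0` Hodge tensors under the derivation
action `tensorSpaceDeriv`; Deligne, LNM 900, I Prop. 3.1 and 3.4).

**Proof** (Deligne, LNM 900, I §3 — `MT` is the stabiliser of the Hodge tensors — plus flat base
change `ℚ → ℂ`; the `ℂ`-linear derivation action `D^{a,b}` (an explicit term, written out below as
in the helper file) and its transport are in the helper file `…TensorComparisonTransport`).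
1. `mem_range_homBaseChange_mumfordTateLieAlgebra_iff`: under the comparison
   `homBaseChange : ℂ ⊗ End_ℚ V ≅ End_ℂ(ℂ ⊗ V)` (`homBaseChange_bijective`), the complexified Lie
   algebra `ℂ ⊗ 𝔪𝔱(H)` is identified with the annihilator
   `A(H) = {ξ | ξ · 𝒞(1 ⊗ t) = 0 for all weight-0 Hodge tensors t}`: "⊆" by the naturality
   `(homBaseChange ζ) · 𝒞(1 ⊗ t) = 𝒞((X ↦ X · t)_ℂ ζ)`
   (`derivSpaceC_homBaseChange_tensorComparison`); "⊇" by the same naturality, injectivity of `𝒞`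
   (`tensorComparison_injective`) and `mem_baseChange_mumfordTateLieAlgebra_of_forall`: an
   element of `ℂ ⊗ End V` killed by all complexified evaluations `(X ↦ X · t)_ℂ` lies in
   `ℂ ⊗ 𝔪𝔱(H)` (expand along a `ℚ`-basis of `ℂ`).
2. `range_homBaseChange_mumfordTateLieAlgebra_eq_comap`: `A(H) = (Ad ψ)⁻¹ A(H')`, since `ξ` kills
   the span `S_H(a,b)` iff `ψ ξ ψ⁻¹` kills `T ψ (S_H(a,b)) = S_{H'}(a,b)` (equivariance of the
   derivation action, `forall_derivSpaceC_eq_zero_iff_of_map_eq`).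
3. `mtRank_eq_finrank_range_homBaseChange`: `dim_ℚ 𝔪𝔱(H) = dim_ℂ (ℂ ⊗ 𝔪𝔱(H)) = dim_ℂ A(H)`
   (`Module.finrank_baseChange`; `ℂ ⊗ 𝔪𝔱(H) → ℂ ⊗ End V` is injective by flatness), and `Ad ψ` is
   a linear equivalence (`LinearEquiv.finrank_map_eq`).

Everything used is proved in the tree or in Mathlib; no named fact is assumed, no definition is
introduced.

## References

* [Deligne1982HodgeCycles] P. Deligne, Hodge cycles on abelian varieties, in LNM 900 (1982), I §3,
  Prop. 3.1 and 3.4 (the Mumford–Tate group as the stabiliser of the Hodge tensors; its Lie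
  algebra as their annihilator), I 2.9 (transport of Hodge tensors along comparison isomorphisms).
* [DeligneHodgeII1971] P. Deligne, Théorie de Hodge II, Publ. Math. IHÉS 40 (1971), 1.1.6–1.1.12.
* [BaldiKlinglerUllmo2024] G. Baldi, B. Klingler, E. Ullmo, On the distribution of the Hodge locus,
  Invent. Math. 235 (2024), §3.1–3.2 (`dim MT` of a Hodge structure).
-/

noncomputable section

-- every declaration of this problem lives in `Summit.HodgeConjecture.HodgeConjecture.…` (summit = sub-problem)
set_option linter.dupNamespace false

open scoped TensorProduct PiTensorProduct
open Literature.AlgebraicGeometry.Motives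

namespace Summit.HodgeConjecture.HodgeConjecture.Theorems

section Annihilator

universe u

variable {V : Type u} [AddCommGroup V] [Module ℚ V] [HodgeTensorFacts.{u, u}] [Module.Finite ℚ V]
  {n : ℤ}

/-- An element of `ℂ ⊗ End_ℚ V` killed by all the complexified evaluation maps `(X ↦ X · t)_ℂ`,
`t` a weight-`0` Hodge tensor of type `(0,0)`, lies in `ℂ ⊗ 𝔪𝔱(H)` (`Submodule.baseChange`):
expand it as `Σᵢ bᵢ ⊗ Xᵢ` along a `ℚ`-basis `(bᵢ)` of `ℂ` (`TensorProduct.eq_repr_basis_left`);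
then `Σᵢ bᵢ ⊗ (Xᵢ · t) = 0` forces `Xᵢ · t = 0` (`TensorProduct.sum_tmul_basis_left_eq_zero`), so
every `Xᵢ ∈ 𝔪𝔱(H)`. [folklore] -/
theorem mem_baseChange_mumfordTateLieAlgebra_of_forall (H : HodgeStructure V n)
    (ζ : ℂ ⊗[ℚ] Module.End ℚ V)
    (hζ : ∀ a b : ℕ, ((a : ℤ) - b) * n = 0 → ∀ t ∈ (H.tensorSpace a b).hodgeClasses 0,
      ((tensorSpaceDeriv V a b).flip t).baseChange ℂ ζ = 0) :
    ζ ∈ H.mumfordTateLieAlgebra.baseChange ℂ := by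
  let ℬ := Module.Free.chooseBasis ℚ ℂ
  obtain ⟨c, rfl⟩ := TensorProduct.eq_repr_basis_left ℬ ζ
  have hc : ∀ i, c i ∈ H.mumfordTateLieAlgebra := fun i => by
    rw [HodgeStructure.mem_mumfordTateLieAlgebra_iff]
    intro a b hab t ht
    have h := hζ a b hab t ht
    rw [map_finsuppSum] at h
    simp only [LinearMap.baseChange_tmul, LinearMap.flip_apply] at h
    have h' : (Finsupp.mapRange (fun X : Module.End ℚ V => tensorSpaceDeriv V a b X t)
        (by simp) c).sum (fun i y => ℬ i ⊗ₜ[ℚ] y) = 0 := by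
      rw [Finsupp.sum_mapRange_index fun i => by simp]
      exact h
    have h'' := TensorProduct.sum_tmul_basis_left_eq_zero ℬ _ h'
    simpa using DFunLike.congr_fun h'' i
  rw [Finsupp.sum]
  exact Submodule.sum_mem _ fun i _ => Submodule.tmul_mem_baseChange_of_mem _ (hc i)

/-- **The complexified Mumford–Tate Lie algebra is the annihilator of the comparison images of the
Hodge tensors** (Deligne, LNM 900, I Prop. 3.1/3.4, after the flat base change `ℚ → ℂ`): the range
of `homBaseChange ∘ (𝔪𝔱(H) ↪ End V)_ℂ : ℂ ⊗ 𝔪𝔱(H) → End_ℂ(ℂ ⊗ V)` consists exactly of the `ξ`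
with `ξ · 𝒞(1 ⊗ t) = 0` (the `ℂ`-linear derivation action `D^{a,b}_{ℂ ⊗ V}`) for every
weight-`0` Hodge tensor `t` of type `(0,0)`. "⊆": `(homBaseChange ζ) · 𝒞(1 ⊗ t) =
𝒞((X ↦ X · t)_ℂ ζ)` (`derivSpaceC_homBaseChange_tensorComparison`) and `X · t = 0` on `𝔪𝔱(H)`;
"⊇": `homBaseChange` is onto (`homBaseChange_bijective`), `𝒞` is injective
(`tensorComparison_injective`), and `mem_baseChange_mumfordTateLieAlgebra_of_forall`.
[cite: Deligne1982HodgeCycles, I Prop. 3.1 and 3.4] -/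
theorem mem_range_homBaseChange_mumfordTateLieAlgebra_iff (H : HodgeStructure V n)
    (ξ : Module.End ℂ (ℂ ⊗[ℚ] V)) :
    ξ ∈ LinearMap.range (HodgeStructure.homBaseChange V V ∘ₗ
        H.mumfordTateLieAlgebra.subtype.baseChange ℂ) ↔
      ∀ a b : ℕ, ((a : ℤ) - b) * n = 0 → ∀ t ∈ (H.tensorSpace a b).hodgeClasses 0,
        ((LinearMap.rTensorHom _ ∘ₗ
            ∑ i : Fin a, (PiTensorProduct.mapMultilinear ℂ (fun _ : Fin a => ℂ ⊗[ℚ] V)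
              (fun _ : Fin a => ℂ ⊗[ℚ] V)).toLinearMap (fun _ => LinearMap.id) i) +
          LinearMap.lTensorHom _ ∘ₗ
            (∑ i : Fin b, (PiTensorProduct.mapMultilinear ℂ
              (fun _ : Fin b => Module.Dual ℂ (ℂ ⊗[ℚ] V))
              (fun _ : Fin b => Module.Dual ℂ (ℂ ⊗[ℚ] V))).toLinearMap
                (fun _ => LinearMap.id) i) ∘ₗ (-Module.Dual.transpose) :
          Module.End ℂ (ℂ ⊗[ℚ] V) →ₗ[ℂ]
            Module.End ℂ ((⨂[ℂ]^a (ℂ ⊗[ℚ] V)) ⊗[ℂ] (⨂[ℂ]^b (Module.Dual ℂ (ℂ ⊗[ℚ] V)))))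
          ξ (((TensorProduct.map (HodgeStructure.piTensorBaseChange V (Fin a))
              ((PiTensorProduct.map fun _ => HodgeStructure.dualBaseChange V) ∘ₗ
                HodgeStructure.piTensorBaseChange _ (Fin b))) ∘ₗ
            (HodgeStructure.tensorBaseChange _ _).toLinearMap) ((1 : ℂ) ⊗ₜ[ℚ] t)) = 0 := by
  constructor
  · rintro ⟨ζ, rfl⟩ a b hab t ht
    rw [LinearMap.comp_apply, derivSpaceC_homBaseChange_tensorComparison,
      ← LinearMap.comp_apply (((tensorSpaceDeriv V a b).flip t).baseChange ℂ),
      ← LinearMap.baseChange_comp]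
    have h0 : (tensorSpaceDeriv V a b).flip t ∘ₗ H.mumfordTateLieAlgebra.subtype = 0 := by
      ext X
      exact X.2 a b hab t ht
    rw [h0, LinearMap.baseChange_zero, LinearMap.zero_apply, map_zero]
  · intro hξ
    obtain ⟨ζ, rfl⟩ := (HodgeStructure.homBaseChange_bijective (V := V) (W := V)).2 ξ
    have hζ : ζ ∈ H.mumfordTateLieAlgebra.baseChange ℂ := by
      refine mem_baseChange_mumfordTateLieAlgebra_of_forall H ζ fun a b hab t ht => ?_
      apply tensorComparison_injective (V := V) a b
      rw [map_zero, ← derivSpaceC_homBaseChange_tensorComparison]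
      exact hξ a b hab t ht
    obtain ⟨ζ', rfl⟩ : ζ ∈ LinearMap.range (H.mumfordTateLieAlgebra.subtype.baseChange ℂ) := hζ
    exact ⟨ζ', rfl⟩

/-- **`dim_ℚ 𝔪𝔱(H) = dim_ℂ` of the range of `ℂ ⊗ 𝔪𝔱(H) → End_ℂ(ℂ ⊗ V)`**:
`ℂ ⊗ 𝔪𝔱(H) → ℂ ⊗ End V` is injective (`ℂ` is flat over `ℚ`), `homBaseChange` is bijective
(`homBaseChange_bijective`), and `dim_ℂ (ℂ ⊗ 𝔪𝔱(H)) = dim_ℚ 𝔪𝔱(H)` (`Module.finrank_baseChange`).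
[folklore] -/
theorem mtRank_eq_finrank_range_homBaseChange (H : HodgeStructure V n) :
    H.mtRank = Module.finrank ℂ (LinearMap.range (HodgeStructure.homBaseChange V V ∘ₗ
      H.mumfordTateLieAlgebra.subtype.baseChange ℂ)) := by
  have hinj : Function.Injective (HodgeStructure.homBaseChange V V ∘ₗ
      H.mumfordTateLieAlgebra.subtype.baseChange ℂ) :=
    HodgeStructure.homBaseChange_bijective.1.comp
      (Module.Flat.lTensor_preserves_injective_linearMap (M := ℂ) _
        H.mumfordTateLieAlgebra.injective_subtype)
  rw [LinearMap.finrank_range_of_inj hinj, Module.finrank_baseChange]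
  rfl

/-- **Transport of the annihilator description along `ψ`** (Deligne, LNM 900, I §3 with 2.9): for
Hodge structures `H` on `V` and `H'` on `V'` of the same weight and a `ℂ`-linear
`ψ : ℂ ⊗ V ≃ ℂ ⊗ V'` whose tensor functoriality `T ψ` carries the span of the comparison images
of the weight-`0` Hodge tensors of `H` onto that of `H'` (for every `(a, b)` of weight `0`), the
subspace `A(H) ⊆ End_ℂ(ℂ ⊗ V)` of `mem_range_homBaseChange_mumfordTateLieAlgebra_iff` is the
preimage of `A(H')` under `Ad ψ : ξ ↦ ψ ξ ψ⁻¹` (`LinearEquiv.conj ψ`): `ξ` kills the generators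
`𝒞(1 ⊗ t)` iff it kills their span (`forall_mem_span_image_eq_zero_iff`) iff `ψ ξ ψ⁻¹` kills
`T ψ` of that span (`forall_derivSpaceC_eq_zero_iff_of_map_eq`), which is the span for `H'`.
[cite: Deligne1982HodgeCycles, I Prop. 3.1 and 3.4] -/
theorem range_homBaseChange_mumfordTateLieAlgebra_eq_comap {V' : Type u} [AddCommGroup V']
    [Module ℚ V'] [Module.Finite ℚ V'] (H : HodgeStructure V n) (H' : HodgeStructure V' n)
    (ψ : ℂ ⊗[ℚ] V ≃ₗ[ℂ] ℂ ⊗[ℚ] V')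
    (hψ : ∀ a b : ℕ, ((a : ℤ) - b) * n = 0 →
      (Submodule.span ℂ ((fun t =>
        ((TensorProduct.map (HodgeStructure.piTensorBaseChange V (Fin a))
            ((PiTensorProduct.map fun _ => HodgeStructure.dualBaseChange V) ∘ₗ
              HodgeStructure.piTensorBaseChange _ (Fin b))) ∘ₗ
          (HodgeStructure.tensorBaseChange _ _).toLinearMap) ((1 : ℂ) ⊗ₜ[ℚ] t)) ''
            ((H.tensorSpace a b).hodgeClasses 0 : Set (hodgeTensorSpace V a b)))).map
        (TensorProduct.congr (PiTensorProduct.congr fun _ : Fin a => ψ)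
          (PiTensorProduct.congr fun _ : Fin b => ψ.symm.dualMap)).toLinearMap =
      Submodule.span ℂ ((fun t =>
        ((TensorProduct.map (HodgeStructure.piTensorBaseChange V' (Fin a))
            ((PiTensorProduct.map fun _ => HodgeStructure.dualBaseChange V') ∘ₗ
              HodgeStructure.piTensorBaseChange _ (Fin b))) ∘ₗ
          (HodgeStructure.tensorBaseChange _ _).toLinearMap) ((1 : ℂ) ⊗ₜ[ℚ] t)) ''
            ((H'.tensorSpace a b).hodgeClasses 0 : Set (hodgeTensorSpace V' a b)))) :
    LinearMap.range (HodgeStructure.homBaseChange V V ∘ₗ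
        H.mumfordTateLieAlgebra.subtype.baseChange ℂ) =
      (LinearMap.range (HodgeStructure.homBaseChange V' V' ∘ₗ
        H'.mumfordTateLieAlgebra.subtype.baseChange ℂ)).comap
          (ψ.conj : Module.End ℂ (ℂ ⊗[ℚ] V) →ₗ[ℂ] Module.End ℂ (ℂ ⊗[ℚ] V')) := by
  ext ξ
  simp only [Submodule.mem_comap, LinearEquiv.coe_coe,
    mem_range_homBaseChange_mumfordTateLieAlgebra_iff]
  refine forall₃_congr fun a b hab => ?_
  have key := forall_derivSpaceC_eq_zero_iff_of_map_eq ψ a b _ _ (hψ a b hab) ξ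
  rw [forall_mem_span_image_eq_zero_iff, forall_mem_span_image_eq_zero_iff] at key
  exact key

end Annihilator

/-- STUB S2 of the line skeleton `Cruxes/QbarGenericIsHodgeGeneric/Lines/birth.lean` (reshape r6),
PROVED — **a `ℂ`-linear comparison matching the Hodge-tensor spans forces equal Mumford–Tate
rank.** For finite-dimensional `ℚ`-Hodge structures `H` on `V`, `H'` on `V'` of the same weight
`n` and a `ℂ`-linear `ψ : ℂ ⊗ V ≃ ℂ ⊗ V'` such that, for every `(a, b)` with `(a - b) n = 0`,
`T ψ = ψ^{⊗a} ⊗ ((ψ⁻¹)ᵀ)^{⊗b}` maps the `ℂ`-span of the comparison images `𝒞(1 ⊗ t)` of the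
weight-`0` Hodge tensors `t ∈ T^{a,b} V` of type `(0,0)` onto the corresponding span for `H'`, one
has `dim MT(H) = dim MT(H')`. Proof: `dim_ℚ 𝔪𝔱(H) = dim_ℂ A(H)`
(`mtRank_eq_finrank_range_homBaseChange`: flat base change and
`mem_range_homBaseChange_mumfordTateLieAlgebra_iff`), `A(H) = (Ad ψ)⁻¹ A(H')`
(`range_homBaseChange_mumfordTateLieAlgebra_eq_comap`: equivariance of the `ℂ`-linear derivation
action), and `Ad ψ` is a linear equivalence. This is the linear algebra of Deligne, LNM 900, I
Prop. 3.1/3.4 (the Mumford–Tate group is the stabiliser of the Hodge tensors) combined with the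
transport of I 2.9; no classicality, polarization or named fact is needed.
[cite: Deligne1982HodgeCycles, I Prop. 3.1 and 3.4] -/
theorem stub_mtRank_eq_of_tensorComparison :
    ∀ [HodgeTensorFacts.{0, 0}] {V V' : Type} [AddCommGroup V] [Module ℚ V] [Module.Finite ℚ V] [AddCommGroup V'] [Module ℚ V'] [Module.Finite ℚ V'] {n : ℤ} (H : HodgeStructure V n) (H' : HodgeStructure V' n) (ψ : ℂ ⊗[ℚ] V ≃ₗ[ℂ] ℂ ⊗[ℚ] V'), (∀ a b : ℕ, ((a : ℤ) - b) * (n) = 0 → Submodule.map (TensorProduct.congr (PiTensorProduct.congr fun _ : Fin a => ψ) (PiTensorProduct.congr fun _ : Fin b => ψ.symm.dualMap)).toLinearMap (Submodule.span ℂ ((fun t => ((TensorProduct.map (HodgeStructure.piTensorBaseChange (V) (Fin a)) ((PiTensorProduct.map fun _ : Fin b => HodgeStructure.dualBaseChange (V)) ∘ₗ HodgeStructure.piTensorBaseChange (Module.Dual ℚ (V)) (Fin b))) ∘ₗ (HodgeStructure.tensorBaseChange (⨂[ℚ]^a (V)) (⨂[ℚ]^b (Module.Dual ℚ (V)))).toLinearMap)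 ((1 : ℂ) ⊗ₜ[ℚ] t)) '' (((H).tensorSpace a b).hodgeClasses 0 : Set (hodgeTensorSpace (V) a b)))) = (Submodule.span ℂ ((fun t => ((TensorProduct.map (HodgeStructure.piTensorBaseChange (V') (Fin a)) ((PiTensorProduct.map fun _ : Fin b => HodgeStructure.dualBaseChange (V')) ∘ₗ HodgeStructure.piTensorBaseChange (Module.Dual ℚ (V')) (Fin b))) ∘ₗ (HodgeStructure.tensorBaseChange (⨂[ℚ]^a (V')) (⨂[ℚ]^b (Module.Dual ℚ (V')))).toLinearMap) ((1 : ℂ) ⊗ₜ[ℚ] t)) '' (((H').tensorSpace a b).hodgeClasses 0 : Set (hodgeTensorSpace (V') a b))))) → H.mtRank = H'.mtRank := by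
  intro _ V V' _ _ _ _ _ _ n H H' ψ hψ
  rw [mtRank_eq_finrank_range_homBaseChange H, mtRank_eq_finrank_range_homBaseChange H',
    range_homBaseChange_mumfordTateLieAlgebra_eq_comap H H' ψ hψ, Submodule.comap_equiv_eq_map_symm]
  exact LinearEquiv.finrank_map_eq _ _

end Summit.HodgeConjecture.HodgeConjecture.Theorems

end
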